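import Mathlib
import HarnessLib
import Literature.GroupTheory.CombinatorialGroupTheory.SignedHurwitzAction
import Literature.GroupTheory.CombinatorialGroupTheory.SignedHurwitzStabilisation

/-!
# The non-vanishing hypothesis is load-bearing in stub `stub_exchange` (line `modp-braid-orbits`,
reshape r3; crux `ConvexBisection.AcyclicBisectionExists`, item stmt-SmoothPoincare4-10508)

Negative lemma (refuter, drefute), stated inline without auxiliary definitions:
`not_stub_exchange_without_nonzero` — the registered exchange engine `stub_exchange` of the checked
skeleton `Cruxes/AcyclicBisectionExists/Lines/modp-braid-orbits.lean` (r3) with its hypothesis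
`∀ x ∈ l, x.1 ≠ 0` deleted (all other sub-terms verbatim) is FALSE.

Mechanism (§1): a ZERO positive letter is inert under every move of `Reach` — a signed Hurwitz step
either carries it along or rewrites it as `0 - c • b` / `b + c • 0` with `c = ± ω(·, 0) = 0`, and a
stabilisation-pair step embeds it as `embed 0 = 0`; so `(0, +) ∈ l` persists along `Reach`.  Then
(§2) the positive classes of any descendant with `2g'` positive letters are at most `2g' - 1` non-zero
vectors and cannot span `ℚ^{2g'}`.  Witness (§3): `g = 1`, `l = (0,+)(e,+)(e,−)(f,−)` — four letters,
two positive, letters `{0, e, f}` spanning `ℚ²`.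

Moral for the line: the dictionary stub must (and does, r3) output NON-ZERO classes ("allowable"
vanishing cycles); that clause is necessary for the E1 engine, not decoration.
-/

noncomputable section

-- the prescribed namespace `Summit.<P>.<Sub>.…` duplicates `SmoothPoincare4` (P = Sub)
set_option linter.dupNamespace false

namespace Summit.SmoothPoincare4.SmoothPoincare4.Theorems.AcyclicBisectionExists.Negative.ExchangeNonzero

open Literature.GroupTheory.CombinatorialGroupTheory.SignedHurwitz

/-! ## §1 A zero positive letter persists along `Reach` -/

/-- A signed Hurwitz step keeps a zero positive letter (any pairing). [folklore] -/
theorem zero_pos_mem_of_hurwitzStep {R : Type*} [CommRing R] {V : Type*} [AddCommGroup V] [Module R V]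
    (B : V →ₗ[R] V →ₗ[R] R) {l l' : List (V × Bool)} (h : HurwitzStep B l l')
    (h0 : ((0 : V), true) ∈ l) : ((0 : V), true) ∈ l' := by
  obtain ⟨pre, suf, a, b, rfl, hl'⟩ := h
  simp only [List.mem_append, List.mem_cons] at h0
  rcases hl' with rfl | rfl
  · simp only [List.mem_append, List.mem_cons]
    rcases h0 with h0 | h0 | h0 | h0
    · exact Or.inl h0
    · exact Or.inr (Or.inr (Or.inl h0))
    · refine Or.inr (Or.inl ?_)
      rw [← h0]
      simp
    · exact Or.inr (Or.inr (Or.inr h0))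
  · simp only [List.mem_append, List.mem_cons]
    rcases h0 with h0 | h0 | h0 | h0
    · exact Or.inl h0
    · refine Or.inr (Or.inr (Or.inl ?_))
      rw [← h0]
      simp
    · exact Or.inr (Or.inl h0)
    · exact Or.inr (Or.inr (Or.inr h0))

/-- A stabilisation-pair step keeps a zero positive letter. [folklore] -/
theorem zero_pos_mem_of_stabStep {g : ℕ} {l : IntWord g} {l' : IntWord (g + 1)} (h : StabStep g l l')
    (h0 : ((0 : Fin g ⊕ Fin g → ℤ), true) ∈ l) :
    ((0 : Fin (g + 1) ⊕ Fin (g + 1) → ℤ), true) ∈ l' := by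
  obtain ⟨A, B, c, -, rfl, rfl⟩ := h
  have key : ∀ X : IntWord g, ((0 : Fin g ⊕ Fin g → ℤ), true) ∈ X →
      ((0 : Fin (g + 1) ⊕ Fin (g + 1) → ℤ), true) ∈ mapWord (embed g) X := fun X hX =>
    List.mem_map.mpr ⟨(0, true), hX, by simp [embed_zero]⟩
  rcases List.mem_append.mp h0 with hA | hB
  · exact List.mem_append_left _ (List.mem_append_left _ (key A hA))
  · exact List.mem_append_right _ (key B hB)

/-- A zero positive letter persists along `Reach`. [folklore] -/
theorem zero_pos_mem_of_reach {g : ℕ} {l : IntWord g} {g' : ℕ} {l' : IntWord g'} (h : Reach g l g' l')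
    (h0 : ((0 : Fin g ⊕ Fin g → ℤ), true) ∈ l) : ((0 : Fin g' ⊕ Fin g' → ℤ), true) ∈ l' := by
  induction h with
  | refl => exact h0
  | hurwitz _ hstep ih => exact zero_pos_mem_of_hurwitzStep _ hstep ih
  | stab _ hstep ih => exact zero_pos_mem_of_stabStep hstep ih

/-! ## §2 With a zero positive letter, `2g'` positive letters never span `ℚ^{2g'}` -/

/-- If a word over a `K`-space of dimension `n` has exactly `n` positive letters, one of them zero,
its positive classes do not span. [folklore] -/
theorem span_pos_ne_top_of_zero_mem {K : Type*} [Field K] {V : Type*} [AddCommGroup V] [Module K V]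
    [FiniteDimensional K V] (m : List (V × Bool))
    (hlen : (m.filter (·.2)).length = Module.finrank K V) (h0 : ((0 : V), true) ∈ m) :
    Submodule.span K (classesOfSign m true) ≠ ⊤ := by
  classical
  set mP := m.filter (·.2) with hmP
  have hmemP : ∀ v, (v, true) ∈ m → (v, true) ∈ mP := fun v hv =>
    List.mem_filter.mpr ⟨hv, rfl⟩
  -- the positive classes are entries of `mP`
  let fam : Fin mP.length → V := fun i => (mP.get i).1
  obtain ⟨i₀, hi₀⟩ := List.get_of_mem (hmemP 0 h0)
  have hfam0 : fam i₀ = 0 := by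
    show (mP.get i₀).1 = 0
    rw [hi₀]
  have hsub : classesOfSign m true ⊆ Set.range fam := by
    intro v hv
    obtain ⟨i, hi⟩ := List.get_of_mem (hmemP v hv)
    exact ⟨i, by show (mP.get i).1 = v; rw [hi]⟩
  -- drop the zero entry
  have hle : Submodule.span K (Set.range fam) ≤
      Submodule.span K (((Finset.univ.erase i₀).image fam : Finset V) : Set V) := by
    refine Submodule.span_le.mpr ?_
    rintro _ ⟨i, rfl⟩
    by_cases hi : i = i₀
    · subst hi; rw [hfam0]; exact Submodule.zero_mem _
    · exact Submodule.subset_span (Finset.mem_coe.mpr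
        (Finset.mem_image.mpr ⟨i, Finset.mem_erase.mpr ⟨hi, Finset.mem_univ _⟩, rfl⟩))
  have hcard : ((Finset.univ.erase i₀).image fam).card ≤ mP.length - 1 :=
    (Finset.card_image_le).trans (by rw [Finset.card_erase_of_mem (Finset.mem_univ _), Finset.card_univ,
      Fintype.card_fin])
  have hpos : 0 < mP.length := Fin.pos i₀
  intro htop
  have h1 : Module.finrank K V ≤ mP.length - 1 := by
    calc Module.finrank K V
        = Module.finrank K (⊤ : Submodule K V) := (finrank_top K V).symm
      _ = Module.finrank K (Submodule.span K (classesOfSign m true)) := by rw [htop]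
      _ ≤ Module.finrank K (Submodule.span K (Set.range fam)) :=
          Submodule.finrank_mono (Submodule.span_mono hsub)
      _ ≤ Module.finrank K (Submodule.span K (((Finset.univ.erase i₀).image fam : Finset V) : Set V)) :=
          Submodule.finrank_mono hle
      _ ≤ ((Finset.univ.erase i₀).image fam).card := finrank_span_finset_le_card _
      _ ≤ mP.length - 1 := hcard
  rw [← hlen] at h1
  omega

/-! ## §3 The witness -/

/-- **The hypothesis `∀ x ∈ l, x.1 ≠ 0` of `stub_exchange` is load-bearing.**  With it deleted
(everything else verbatim) the exchange engine is false: at genus `1` the word `(0,+)(e,+)(e,−)(f,−)`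
has `4` letters, `2` positive, and letters `{0, e, f}` spanning `ℚ²`, but every `Reach`-descendant
keeps the zero positive letter, so its positive classes never span. [folklore] -/
theorem not_stub_exchange_without_nonzero :
    ¬ ∀ (g : ℕ) (l : IntWord g),
      l.length = 4 * g → (l.filter (·.2)).length = 2 * g →
      Submodule.span ℚ (letters (ratWord l)) = ⊤ →
      ∃ (g' : ℕ) (l' : IntWord g'),
        Reach g l g' l' ∧ l'.length = 4 * g' ∧ (l'.filter (·.2)).length = 2 * g' ∧
        Submodule.span ℚ (classesOfSign (ratWord l') true) = ⊤ := by
  intro h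
  set e : Fin 1 ⊕ Fin 1 → ℤ := Pi.single (Sum.inl 0) 1 with he
  set f : Fin 1 ⊕ Fin 1 → ℤ := Pi.single (Sum.inr 0) 1 with hf
  set l : IntWord 1 := [(0, true), (e, true), (e, false), (f, false)] with hl
  have hspan : Submodule.span ℚ (letters (ratWord l)) = ⊤ := by
    have memE : (Pi.basisFun ℚ (Fin 1 ⊕ Fin 1)) (Sum.inl 0) ∈ letters (ratWord l) :=
      ⟨true, List.mem_map.mpr ⟨(e, true), by simp [hl],
        Prod.ext (funext fun i => by rcases i with i | i <;> fin_cases i <;> simp [he]) rfl⟩⟩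
    have memF : (Pi.basisFun ℚ (Fin 1 ⊕ Fin 1)) (Sum.inr 0) ∈ letters (ratWord l) :=
      ⟨false, List.mem_map.mpr ⟨(f, false), by simp [hl],
        Prod.ext (funext fun i => by rcases i with i | i <;> fin_cases i <;> simp [hf]) rfl⟩⟩
    apply top_unique
    rw [← (Pi.basisFun ℚ (Fin 1 ⊕ Fin 1)).span_eq, Submodule.span_le]
    rintro _ ⟨j, rfl⟩
    apply Submodule.subset_span
    rcases j with j | j <;> fin_cases j
    · exact memE
    · exact memF
  obtain ⟨g', l', hreach, -, hbal', hspan'⟩ := h 1 l (by simp [hl]) (by simp [hl]) hspan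
  have h0 : ((0 : Fin g' ⊕ Fin g' → ℤ), true) ∈ l' :=
    zero_pos_mem_of_reach hreach (by simp [hl])
  have h0Q : ((0 : Fin g' ⊕ Fin g' → ℚ), true) ∈ ratWord l' :=
    List.mem_map.mpr ⟨(0, true), h0, by ext <;> simp⟩
  refine span_pos_ne_top_of_zero_mem (ratWord l') ?_ h0Q hspan'
  rw [ratWord, length_filter_mapWord, hbal', Module.finrank_fintype_fun_eq_card, Fintype.card_sum,
    Fintype.card_fin, two_mul]

end Summit.SmoothPoincare4.SmoothPoincare4.Theorems.AcyclicBisectionExists.Negative.ExchangeNonzero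

end
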